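import Summits.RiemannHypothesis.RiemannHypothesis.Theses.SignCone
import Literature.NumberTheory.LFunctions.WeilWindowSimpleEven
import Literature.NumberTheory.LFunctions.WeilExplicitProofs
import Literature.NumberTheory.LFunctions.WeilMellinBounds
import HarnessLib

/-!
# Route SignCone, item `ExactConeRigidity` (stmt-RiemannHypothesis-16306) — toolkit for the conic
duality at a cutoff: finite-dimensional duality, the Weil cone `P(a)`, linearity of `W_ar`

The item `ExactConeRigidity` asks: if the PRIME-FREE sign-cone inequality holds WITHOUT slack at
every cutoff `a > 0` — `Re W_ar(F) ≥ 0` for every node-nonnegative `F` in the Weil cone `P(a)`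
(finite sums `F = Σ_i g_i ⋆ g̃_i`, `g_i` smooth with `tsupport g_i ⊆ [-a, a]`,
`Re F(log n) ≥ 0` for all `n ≥ 2`), `W_ar = weilPolarTerm + weilArchTerm` — then the Riemann
hypothesis; the 2001 sketch is duality `K_a ≠ ∅`, compactness, rigidity `K = {Λ}`, Weil's
criterion. This file is the toolkit for the DUALITY step (carried out in
`SignConeExactConeRigidityDuality.lean`):

* `finiteCone_duality` — finite-dimensional conic (Lagrangian) duality with a Slater point: for a
  convex cone `C ⊆ ℝ × ℝ^ι` (`ι` finite) on which "all coordinates `≥ 0` ⇒ first coordinate `≥ 0`"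
  and which contains a point with all coordinates `≥ 1`, there are `c_i ≥ 0` with
  `Σ c_i p_i ≤ p_0` on `C` (strict separation of `(-1, 0)` from the closure of the monotone hull
  `C + (ℝ≥0 × ℝ≤0^ι)` by `geometric_hahn_banach_point_closed`);
* the Weil cone `P(a)`: autocorrelations of window tests vanish for `|t| ≥ 2a`
  (`weilConv_weilReflect_eq_zero_of_le_abs`), family sums are Weil tests (`isWeilTest_familySum`),
  concatenation (`window_append`, `familySum_append`) and `√r`-scaling (`familySum_sqrt_mul`);
* linearity of `W_ar = weilPolarTerm + weilArchTerm` on test functions (`polarArch_add`,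
  `polarArch_const_mul`, `polarArch_zero`), from the tree's `weilMellin_add`,
  `weilArchIntegral_add`, `weilMellin_const_mul`;
* the Slater point (`exists_slater_bump`): one smooth bump on `(-a, a)` has autocorrelation with
  positive real part at every `|t| < 2a`, in particular at every node `log n < 2a`.

Everything is stated in the Literature vocabulary `IsWeilTest`, `weilConv`, `weilReflect`,
`weilMellin`, `weilPolarTerm`, `weilArchTerm` (`Literature.NumberTheory.LFunctions.WeilExplicit`),
which is definitionally the Mathlib-primitive vocabulary of the route's items (route file, CONE
NOTE). Sources: Shapiro 2001 (conic linear duality, Props. 3.1/3.4); Boyd–Vandenberghe §5.3.2;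
archive 2001 fefr Thm 7.2; Bombieri 2000 §§2–4 for the Weil-functional vocabulary.
-/

noncomputable section

open Complex Filter Set MeasureTheory
open scoped Real Topology ComplexConjugate ContDiff

namespace Summit.RiemannHypothesis.RiemannHypothesis.Theorems.SignConeExactConeRigidity

open Literature.NumberTheory.LFunctions

/-! ## Finite-dimensional conic duality with a Slater point -/

/-- **Finite-dimensional conic duality with a Slater point.** Let `C ⊆ ℝ × (ι → ℝ)` (`ι` finite)
contain `0` and be closed under addition and under multiplication by nonnegative reals. If
`p.1 ≥ 0` whenever `p ∈ C` has all coordinates `p.2 i ≥ 0`, and some `p ∈ C` has all `p.2 i ≥ 1`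
(Slater point), then there are `c i ≥ 0` with `Σ_i c i * p.2 i ≤ p.1` for all `p ∈ C`.
Proof: the monotone hull `A = {x | ∃ p ∈ C, p.1 ≤ x.1, x.2 ≤ p.2}` is convex and stays at
distance `≥ 1/(2(1 + p_S.1))` from `(-1, 0)` (Slater), so `geometric_hahn_banach_point_closed`
separates `(-1, 0)` strictly from `closure A`; the separating functional is `≥ 0` on the cone `A`,
positive on `(1, 0)` and `≤ 0` on the `(0, e_i)`, and its coordinates give `c`.
(Shapiro 2001, conic linear duality, Props. 3.1/3.4; Boyd–Vandenberghe §5.3.2.) -/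
theorem finiteCone_duality {ι : Type*} [Fintype ι] {C : Set (ℝ × (ι → ℝ))}
    (h0 : (0 : ℝ × (ι → ℝ)) ∈ C)
    (hadd : ∀ p ∈ C, ∀ q ∈ C, p + q ∈ C)
    (hsmul : ∀ r : ℝ, 0 ≤ r → ∀ p ∈ C, r • p ∈ C)
    (hpos : ∀ p ∈ C, (∀ i, 0 ≤ p.2 i) → 0 ≤ p.1)
    (hslater : ∃ p ∈ C, ∀ i, 1 ≤ p.2 i) :
    ∃ c : ι → ℝ, (∀ i, 0 ≤ c i) ∧ ∀ p ∈ C, ∑ i, c i * p.2 i ≤ p.1 := by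
  classical
  -- the monotone hull `A = C + (ℝ≥0 × ℝ≤0^ι)` of the cone
  set A : Set (ℝ × (ι → ℝ)) := {x | ∃ p ∈ C, p.1 ≤ x.1 ∧ ∀ i, x.2 i ≤ p.2 i} with hA_def
  have hCA : C ⊆ A := fun p hp ↦ ⟨p, hp, le_rfl, fun i ↦ le_rfl⟩
  have hA_conv : Convex ℝ A := by
    intro x hx y hy θ₁ θ₂ hθ₁ hθ₂ _
    obtain ⟨p, hp, hp1, hp2⟩ := hx
    obtain ⟨q, hq, hq1, hq2⟩ := hy
    refine ⟨θ₁ • p + θ₂ • q, hadd _ (hsmul θ₁ hθ₁ p hp) _ (hsmul θ₂ hθ₂ q hq), ?_, fun i ↦ ?_⟩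
    · simp only [Prod.fst_add, Prod.smul_fst, smul_eq_mul]
      nlinarith
    · simp only [Prod.snd_add, Prod.smul_snd, Pi.add_apply, Pi.smul_apply, smul_eq_mul]
      nlinarith [hp2 i, hq2 i]
  have hA_smul : ∀ r : ℝ, 0 < r → ∀ x ∈ A, r • x ∈ A := by
    rintro r hr x ⟨p, hp, hp1, hp2⟩
    refine ⟨r • p, hsmul r hr.le p hp, ?_, fun i ↦ ?_⟩
    · simp only [Prod.smul_fst, smul_eq_mul]
      exact mul_le_mul_of_nonneg_left hp1 hr.le
    · simp only [Prod.smul_snd, Pi.smul_apply, smul_eq_mul]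
      exact mul_le_mul_of_nonneg_left (hp2 i) hr.le
  -- the Slater point and the separation radius
  obtain ⟨ps, hps, hps1⟩ := hslater
  have hw : 0 ≤ ps.1 := hpos ps hps fun i ↦ zero_le_one.trans (hps1 i)
  set δ : ℝ := 1 / (2 * (1 + ps.1)) with hδ_def
  have hδ : 0 < δ := by positivity
  have hδ1 : δ * (1 + ps.1) = 1 / 2 := by
    rw [hδ_def]
    field_simp
  -- the point `(-1, 0)` is at distance `≥ δ` from `A`
  set x₀ : ℝ × (ι → ℝ) := ((-1 : ℝ), (0 : ι → ℝ)) with hx₀_def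
  have hball : ∀ x ∈ A, δ ≤ dist x x₀ := by
    rintro x ⟨p, hp, hp1, hp2⟩
    by_contra hlt
    push Not at hlt
    have hn : ‖x - x₀‖ < δ := by rwa [← dist_eq_norm]
    have h1 : x.1 < -1 + δ := by
      have h := (norm_fst_le (x - x₀)).trans_lt hn
      rw [Prod.fst_sub, Real.norm_eq_abs, abs_lt] at h
      have : x₀.1 = -1 := rfl
      linarith [h.2]
    have h2 : ∀ i, -δ < p.2 i := by
      intro i
      have h := ((norm_le_pi_norm (x - x₀).2 i).trans (norm_snd_le (x - x₀))).trans_lt hn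
      rw [Prod.snd_sub, Pi.sub_apply, Real.norm_eq_abs, abs_lt] at h
      have : x₀.2 i = 0 := rfl
      linarith [h.1, hp2 i]
    have hp' := hpos (p + δ • ps) (hadd p hp _ (hsmul δ hδ.le ps hps)) (fun i ↦ by
      simp only [Prod.snd_add, Pi.add_apply, Prod.smul_snd, Pi.smul_apply, smul_eq_mul]
      nlinarith [h2 i, hps1 i, hδ])
    simp only [Prod.fst_add, Prod.smul_fst, smul_eq_mul] at hp'
    nlinarith [hp1, h1, hδ1, hw]
  have hx₀ : x₀ ∉ closure A := by
    rw [Metric.mem_closure_iff]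
    push Not
    exact ⟨δ, hδ, fun x hx ↦ by rw [dist_comm]; exact hball x hx⟩
  -- strict separation of `x₀` from the closed convex set `closure A`
  obtain ⟨f, u, hfx, hfA⟩ :=
    geometric_hahn_banach_point_closed hA_conv.closure isClosed_closure hx₀
  have hfA' : ∀ x ∈ A, u < f x := fun x hx ↦ hfA x (subset_closure hx)
  have h0A : (0 : ℝ × (ι → ℝ)) ∈ A := hCA h0
  have hu : u < 0 := by simpa using hfA' 0 h0A
  have hfnn : ∀ x ∈ A, 0 ≤ f x := by
    intro x hx
    by_contra hneg
    push Not at hneg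
    have hr : 0 < u / f x := div_pos_of_neg_of_neg hu hneg
    have h := hfA' _ (hA_smul _ hr x hx)
    rw [map_smul, smul_eq_mul, div_mul_cancel₀ _ hneg.ne] at h
    exact lt_irrefl _ h
  -- coordinates
  set e₀ : ℝ × (ι → ℝ) := ((1 : ℝ), (0 : ι → ℝ)) with he₀_def
  set e : ι → ℝ × (ι → ℝ) := fun i ↦ ((0 : ℝ), Pi.single i (1 : ℝ)) with he_def
  have he₀A : e₀ ∈ A := ⟨0, h0, by simp [he₀_def], fun i ↦ by simp [he₀_def]⟩
  have heA : ∀ i, -e i ∈ A := fun i ↦ ⟨0, h0, by simp [he_def], fun j ↦ by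
    simp only [he_def, Prod.snd_neg, Pi.neg_apply, Prod.snd_zero, Pi.zero_apply, neg_nonpos,
      Pi.single_apply]
    split_ifs <;> norm_num⟩
  have hx₀e : x₀ = -e₀ := by
    simp [hx₀_def, he₀_def]
  have hl0 : 0 < f e₀ := by
    have : f x₀ = -f e₀ := by rw [hx₀e, map_neg]
    linarith
  have hfe : ∀ i, f (e i) ≤ 0 := fun i ↦ by
    have h := hfnn _ (heA i)
    rw [map_neg] at h
    linarith
  refine ⟨fun i ↦ -f (e i) / f e₀, fun i ↦ div_nonneg (by linarith [hfe i]) hl0.le,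
    fun p hp ↦ ?_⟩
  have hdecomp : p = p.1 • e₀ + ∑ i, p.2 i • e i := by
    ext j
    · simp [he₀_def, he_def, Prod.fst_sum]
    · simp [he₀_def, he_def, Prod.snd_sum, Finset.sum_apply, Pi.single_apply]
  have hfp : f p = p.1 * f e₀ + ∑ i, p.2 i * f (e i) := by
    conv_lhs => rw [hdecomp]
    simp only [map_add, map_sum, map_smul, smul_eq_mul]
  have hp0 : 0 ≤ f p := hfnn p (hCA hp)
  rw [hfp] at hp0
  have hsum : ∑ i, -f (e i) / f e₀ * p.2 i = (-(∑ i, p.2 i * f (e i))) / f e₀ := by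
    rw [← Finset.sum_neg_distrib, Finset.sum_div]
    refine Finset.sum_congr rfl fun i _ ↦ ?_
    ring
  rw [hsum, div_le_iff₀ hl0]
  linarith

/-! ## Window test functions: supports of autocorrelations and of family sums -/

variable {g : ℝ → ℂ} {a : ℝ}

/-- If `tsupport g ⊆ [-a, a]` then `g ⋆ g̃` vanishes wherever `2a ≤ |t|` (including the
boundary `|t| = 2a`: the support of the continuous function `g ⋆ g̃` is an OPEN subset of
`[-a, a] + [-a, a] ⊆ [-2a, 2a]`). -/
theorem weilConv_weilReflect_eq_zero_of_le_abs (hg : IsWeilTest g)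
    (hsupp : tsupport g ⊆ Icc (-a) a) {t : ℝ} (ht : 2 * a ≤ |t|) :
    weilConv g (weilReflect g) t = 0 := by
  have hG : IsWeilTest (weilConv g (weilReflect g)) := hg.weilConv hg.weilReflect
  have hsub : Function.support (weilConv g (weilReflect g)) ⊆ Icc (-(2 * a)) (2 * a) := by
    refine (support_convolution_subset (ContinuousLinearMap.mul ℂ ℂ)).trans ?_
    rw [Set.add_subset_iff]
    intro x hx y hy
    have hx' : x ∈ Icc (-a) a := hsupp (subset_tsupport _ hx)
    have hy' : -y ∈ Icc (-a) a := by
      refine hsupp (subset_tsupport _ ?_)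
      simpa [weilReflect, Function.mem_support] using hy
    simp only [mem_Icc] at hx' hy' ⊢
    constructor <;> linarith
  by_contra hne
  have hev : ∀ᶠ x in 𝓝 t, weilConv g (weilReflect g) x ≠ 0 :=
    hG.1.continuous.continuousAt.eventually_ne hne
  have hmem : Icc (-(2 * a)) (2 * a) ∈ 𝓝 t :=
    Filter.mem_of_superset hev fun x hx ↦ hsub hx
  have hint : t ∈ interior (Icc (-(2 * a)) (2 * a)) := mem_interior_iff_mem_nhds.2 hmem
  rw [interior_Icc, mem_Ioo] at hint
  have := abs_lt.2 ⟨hint.1, hint.2⟩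
  linarith

variable {k : ℕ} {gs : Fin k → ℝ → ℂ}

/-- The family sum `F = Σ_i g_i ⋆ g̃_i` of window test functions vanishes for `2a ≤ |t|`. -/
theorem familySum_eq_zero_of_le_abs
    (hgs : ∀ i, IsWeilTest (gs i) ∧ tsupport (gs i) ⊆ Icc (-a) a) {t : ℝ} (ht : 2 * a ≤ |t|) :
    (∑ i, weilConv (gs i) (weilReflect (gs i)) t) = 0 :=
  Finset.sum_eq_zero fun i _ ↦ weilConv_weilReflect_eq_zero_of_le_abs (hgs i).1 (hgs i).2 ht

/-- The family sum `F = Σ_i g_i ⋆ g̃_i` of window test functions is a Weil test function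
(smooth: `IsWeilTest.weilConv`; compact support: it vanishes off `[-2|a|, 2|a|]`). -/
theorem isWeilTest_familySum
    (hgs : ∀ i, IsWeilTest (gs i) ∧ tsupport (gs i) ⊆ Icc (-a) a) :
    IsWeilTest (fun t ↦ ∑ i, weilConv (gs i) (weilReflect (gs i)) t) := by
  refine ⟨ContDiff.sum fun i _ ↦ ((hgs i).1.weilConv (hgs i).1.weilReflect).1, ?_⟩
  refine HasCompactSupport.of_support_subset_isCompact
    (isCompact_Icc (a := -(2 * |a|)) (b := 2 * |a|)) fun t ht ↦ ?_
  by_contra hnot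
  refine ht (familySum_eq_zero_of_le_abs hgs ?_)
  simp only [mem_Icc, not_and_or, not_le] at hnot
  rcases hnot with h | h
  · linarith [neg_le_abs t, le_abs_self a]
  · linarith [le_abs_self t, le_abs_self a]

/-- Concatenating two window families gives a window family. -/
theorem window_append {k k' : ℕ} {g : Fin k → ℝ → ℂ} {g' : Fin k' → ℝ → ℂ}
    (hg : ∀ i, IsWeilTest (g i) ∧ tsupport (g i) ⊆ Icc (-a) a)
    (hg' : ∀ i, IsWeilTest (g' i) ∧ tsupport (g' i) ⊆ Icc (-a) a) :
    ∀ i, IsWeilTest (Fin.append g g' i) ∧ tsupport (Fin.append g g' i) ⊆ Icc (-a) a := by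
  intro i
  refine Fin.addCases (fun j ↦ ?_) (fun j ↦ ?_) i
  · simpa only [Fin.append_left] using hg j
  · simpa only [Fin.append_right] using hg' j

/-- The family sum of a concatenation is the sum of the family sums. -/
theorem familySum_append {k k' : ℕ} (g : Fin k → ℝ → ℂ) (g' : Fin k' → ℝ → ℂ) :
    (fun t ↦ ∑ i, weilConv (Fin.append g g' i) (weilReflect (Fin.append g g' i)) t) =
      (fun t ↦ ∑ i, weilConv (g i) (weilReflect (g i)) t) +
        fun t ↦ ∑ i, weilConv (g' i) (weilReflect (g' i)) t := by
  funext t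
  simp only [Pi.add_apply, Fin.sum_univ_add, Fin.append_left, Fin.append_right]

/-! ## Linearity of `W_ar = weilPolarTerm + weilArchTerm` -/

/-- `weilArchIntegral (m k) = m · weilArchIntegral k` (no hypotheses; both sides carry the same
junk values). -/
theorem weilArchIntegral_const_mul (m : ℂ) (F : ℝ → ℂ) :
    weilArchIntegral (fun t ↦ m * F t) = m * weilArchIntegral F := by
  simp only [weilArchIntegral, weilMellin_const_mul]
  rw [← integral_const_mul]
  congr 1 with t
  ring

/-- Homogeneity of `W_ar = weilPolarTerm + weilArchTerm` (no hypotheses). -/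
theorem polarArch_const_mul (m : ℂ) (F : ℝ → ℂ) :
    weilPolarTerm (fun t ↦ m * F t) + weilArchTerm (fun t ↦ m * F t) =
      m * (weilPolarTerm F + weilArchTerm F) := by
  simp only [weilPolarTerm, weilArchTerm, weilMellin_const_mul, weilArchIntegral_const_mul]
  ring

/-- `W_ar(0) = 0`. -/
theorem polarArch_zero :
    weilPolarTerm (fun _ : ℝ ↦ (0 : ℂ)) + weilArchTerm (fun _ : ℝ ↦ (0 : ℂ)) = 0 := by
  have h := polarArch_const_mul 0 (fun _ ↦ (0 : ℂ))
  simp only [zero_mul] at h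
  exact h

/-- Additivity of `W_ar` on test functions (`weilMellin_add`, `weilArchIntegral_add`). -/
theorem polarArch_add {F₁ F₂ : ℝ → ℂ} (h₁ : IsWeilTest F₁) (h₂ : IsWeilTest F₂) :
    weilPolarTerm (F₁ + F₂) + weilArchTerm (F₁ + F₂) =
      (weilPolarTerm F₁ + weilArchTerm F₁) + (weilPolarTerm F₂ + weilArchTerm F₂) := by
  have hM := weilMellin_add h₁.1.continuous h₁.2 h₂.1.continuous h₂.2
  simp only [weilPolarTerm, weilArchTerm, hM, weilArchIntegral_add h₁ h₂, Pi.add_apply]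
  ring

/-! ## Scaling a window family by `√r` -/

/-- `(√r g) ⋆ (√r g)̃ = r (g ⋆ g̃)` pointwise for `r ≥ 0`. -/
theorem weilConv_weilReflect_sqrt_mul (r : ℝ) (hr : 0 ≤ r) (g : ℝ → ℂ) :
    weilConv (fun t ↦ (Real.sqrt r : ℂ) * g t) (weilReflect fun t ↦ (Real.sqrt r : ℂ) * g t) =
      fun t ↦ (r : ℂ) * weilConv g (weilReflect g) t := by
  rw [weilReflect_const_mul, weilConv_const_mul_left, weilConv_const_mul_right]
  funext t
  rw [← mul_assoc, Complex.conj_ofReal, ← Complex.ofReal_mul, Real.mul_self_sqrt hr]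

/-- Scaling every member of a family by `√r` multiplies the family sum by `r`. -/
theorem familySum_sqrt_mul (g : Fin k → ℝ → ℂ) (r : ℝ) (hr : 0 ≤ r) :
    (fun t ↦ ∑ i, weilConv (fun u ↦ (Real.sqrt r : ℂ) * g i u)
        (weilReflect fun u ↦ (Real.sqrt r : ℂ) * g i u) t) =
      fun t ↦ (r : ℂ) * ∑ i, weilConv (g i) (weilReflect (g i)) t := by
  funext t
  simp only [weilConv_weilReflect_sqrt_mul r hr, Finset.mul_sum]

/-- Scaling preserves Weil test functions. -/
theorem isWeilTest_const_mul (c : ℂ) (hg : IsWeilTest g) : IsWeilTest fun t ↦ c * g t :=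
  ⟨contDiff_const.mul hg.1, hg.2.mul_left⟩

/-- `Re (g ⋆ g̃)(-t) = Re (g ⋆ g̃)(t)` (`g ⋆ g̃` is hermitian, `conj_weilConv_weilReflect_neg`). -/
theorem weilConv_weilReflect_neg_re (g : ℝ → ℂ) (t : ℝ) :
    (weilConv g (weilReflect g) (-t)).re = (weilConv g (weilReflect g) t).re := by
  rw [← conj_weilConv_weilReflect_neg g t, Complex.conj_re]

/-! ## The Slater point: one bump on `(-a, a)` is positive at every node below `2a` -/

/-- For `a > 0` there is a Weil test `φ` with `tsupport φ ⊆ [-a, a]` whose autocorrelation has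
`Re (φ ⋆ φ̃)(t) > 0` for all `|t| < 2a`: take `φ = b` a smooth bump (`ContDiffBump 0` with radii
`a/2 < a`); then `(φ ⋆ φ̃)(t) = ∫ b(u) b(u - t) du` has a continuous nonnegative integrand which is
positive at `u = t/2`. -/
theorem exists_slater_bump (ha : 0 < a) :
    ∃ φ : ℝ → ℂ, IsWeilTest φ ∧ tsupport φ ⊆ Icc (-a) a ∧
      ∀ t : ℝ, |t| < 2 * a → 0 < (weilConv φ (weilReflect φ) t).re := by
  let b : ContDiffBump (0 : ℝ) := ⟨a / 2, a, by positivity, by linarith⟩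
  refine ⟨fun t ↦ ((b t : ℝ) : ℂ), ⟨?_, ?_⟩, ?_, fun t ht ↦ ?_⟩
  · exact ofRealCLM.contDiff.comp b.contDiff
  · exact b.hasCompactSupport.comp_left Complex.ofReal_zero
  · have h1 : tsupport (fun t ↦ ((b t : ℝ) : ℂ)) = tsupport b :=
      tsupport_comp_eq (g := fun x : ℝ ↦ (x : ℂ)) (fun {x} ↦ Complex.ofReal_eq_zero) b
    rw [h1, b.tsupport_eq, Real.closedBall_eq_Icc, zero_sub, zero_add]
  · have hval : weilConv (fun t ↦ ((b t : ℝ) : ℂ)) (weilReflect fun t ↦ ((b t : ℝ) : ℂ)) t =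
        ((∫ u, b u * b (u - t) : ℝ) : ℂ) := by
      rw [weilConv_apply, ← integral_complex_ofReal]
      congr 1 with u
      simp only [weilReflect, Complex.conj_ofReal, neg_sub]
      push_cast
      ring
    rw [hval, Complex.ofReal_re]
    have hcont : Continuous fun u ↦ b u * b (u - t) :=
      b.continuous.mul (b.continuous.comp (continuous_sub_right t))
    have hcs : HasCompactSupport fun u ↦ b u * b (u - t) := b.hasCompactSupport.mul_right
    refine hcont.integral_pos_of_hasCompactSupport_nonneg_nonzero hcs
      (fun u ↦ mul_nonneg b.nonneg b.nonneg) (x := t / 2) ?_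
    have hmem : ∀ s : ℝ, |s| < a → b s ≠ 0 := fun s hs ↦ by
      refine (b.pos_of_mem_ball ?_).ne'
      simpa [Metric.mem_ball, Real.dist_eq] using hs
    refine mul_ne_zero (hmem _ ?_) (hmem _ ?_)
    · rw [abs_div, abs_two]; linarith
    · rw [show t / 2 - t = -(t / 2) by ring, abs_neg, abs_div, abs_two]; linarith

end Summit.RiemannHypothesis.RiemannHypothesis.Theorems.SignConeExactConeRigidity
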